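import Summits.BirchSwinnertonDyer.BirchSwinnertonDyer.Theorems.KolyvaginDepthDoorDepthTableOddPrimeKit
import Summits.BirchSwinnertonDyer.BirchSwinnertonDyer.Theorems.KolyvaginDepthDoorDepthTableRows1
import Summits.BirchSwinnertonDyer.BirchSwinnertonDyer.Theorems.KolyvaginDepthDoorDepthTableRows4
import Summits.BirchSwinnertonDyer.Rank1Residual.Additive.PointCountEulerNat
import Literature.NumberTheory.EllipticCurves.HeegnerPointsKolyvaginStructure
import HarnessLib
import Literature.NumberTheory.EllipticCurves.JetchevLauterSteinKolyvaginNonvanishing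

/-!
# Route `KolyvaginDepthDoor` — the depth table's CALIBRATION ROWS FILLED BY PRINT (1/2): the cited
# computation (Jetchev–Lauter–Stein 2009 Prop. 3.10 / Rem. 3.11) and the row `389a1` at
# `(p, d_K, ℓ) = (3, −7, 5)` (crux `KolyvaginDepthSupply`, stmt-BirchSwinnertonDyer-21765)

Helper file (`--supports stmt-BirchSwinnertonDyer-21765 --as helper`); it closes nothing and BSD is
not proved by it. HONEST FRAMING: the route's instrument (the DEPTH TABLE: is the first derived
Kolyvagin class `c_1(ℓ)` non-zero?) has exactly three entries IN PRINT, all at `p = 3`: Jetchev–Lauter–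
Stein, J. Number Theory 129 (2009) = arXiv:0707.0032, Prop. 3.10 (`389a1`, `D = 7`, `p = 3`, `ℓ = 5`:
`κ_{5,1} ≠ 0`) and Remark 3.11 (`709a1`, `718b1`, same data). The route header files them as its
CALIBRATION ("consistent; p = 3 is below the crux's p ≥ 5, so it calibrates, not instantiates"). This
file (row `389a1`) and its sequel `…DepthTableJLSRows2` (rows `709a1`, `718b1`, and the three together)
turn the three data points into theorems of the shape of a depth-table row:

  modulo (hK) Kolyvagin 1991 Thm. 4 in its PRINTED `B(E)` form
  (`Kolyvagin1991_selmerCorank_of_kolyvaginClass_ne_zero_of_padicSurj`, companion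
  `KolyvaginDepthDoorDepthTableOddPrimeKit`; the tree's `p ≥ 5` form is its corollary
  `kolyvagin1991_of_padicSurj`) and (hJ) the published computation
  (`JetchevLauterStein2009_kolyvaginClass_five_ne_zero_at_three`, ONE cited fact written inline below for
  gate relocation), for `E ∈ {389a1, 709a1, 718b1}` and any imaginary quadratic `K` with `d_K = −7`:
  `corank_{ℤ_3} Ш(E/ℚ)[3^∞] = 0`, `rank_ℤ E(ℚ) = 2` (exactly), `corank Sel_{3^∞}(E/ℚ) = 2`,
  `corank Sel_{3^∞}(E^{(−7)}/ℚ) = 1`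

with EVERY side condition PROVED in the kernel on the integer models `[0,1,1,−2,0]`, `[0,−1,1,−2,0]`,
`[1,0,1,−5,0]`: `3 ∈ B(E)`, i.e. `ρ̄_{E,3^m}` onto for all `m` (semistable + Mazur's Frobenius witness
at `q = 11, 11, 17` + Serre 1972 Prop. 21 ⇒ `ρ̄_{E,3}` onto; the multiplicative prime `389, 709, 359 ∥ Δ`
⇒ every `3^m`, tree theorem `hasSurjectiveModNGaloisRep_pow_of_hasMultiplicativeReductionAtPrime` — the
`3`-ADIC statement Kolyvagin's `B(E)` asks for and which JLS only check mod `3`), `3 ∤ N` and `3`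
good ORDINARY (`a_3 = −2, −1, −2`; recorded, not needed by the door), the Heegner hypothesis for
`(N, −7)` (`389`, `709`, `2`, `359` split), `5` a Kolyvagin prime with `M(5) = 1 ≥ 1` (`(−7/5) = −1`,
`3 ∣ 6`, `a_5 = −3` for all three), `2 ≤ rank_ℤ E(ℚ)` (kernel certificates
`Curve389a1.two_le_mordellWeilRank`, `KernelCerts002.C709a1/C718b1.two_le_rank`), global minimality
(`isGloballyMinimal_c…`). So the only inputs left are the two named facts — the instrument's first
FILLED rows: "points first, Ш after" certificates of `corank Ш(E)[3^∞] = 0` for three rank-2 curves by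
the anticyclotomic depth door, with no `3`-adic `L`-function, main conjecture or `3`-adic height (the
cyclotomic λ-door of Stein–Wuthrich 2013 is the non-equivalent competitor the route pairs it with).

What this is NOT: an instance of the crux (`p = 3 < 5`); a reproduction of the JLS computation (it is a
named fact, as the tree's `cremona_abs_maninConstant_eq_one_of_level_le`); a class theorem. BSD is not
proved by any of this.

References: [JetchevLauterStein2009] §3 (p. 6: standing hypotheses `p ∤ ND`, `ρ̄_{E,p}` onto), §3.6
Prop. 3.10, Rem. 3.11 (arXiv p. 8); [Kolyvagin1991MathAnn] §1 (B(E)), §2 Thm. 4; [Serre1972] §5.4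
Prop. 21; [SerreAbelianLadic1968] IV §3.4; [Mazur1978] Prop. 6.3 (1); [WZhang2014] Notations (xii);
[CremonaAlgorithms1997] Table 1; [GrossLMS1991] §3 (3.1)–(3.3); [Marcus1977] Ch. 2 Thm. 1, Ch. 3 Thm. 25.
-/

-- D-0017: single-problem summit, `Summit.BirchSwinnertonDyer.BirchSwinnertonDyer.…` repeats a
-- namespace component by design.
set_option linter.dupNamespace false

noncomputable section

open scoped Classical NumberField

/-! ### The cited computation (inline; the gate relocates it under Literature/) -/

namespace Literature.NumberTheory.EllipticCurves

open Literature.NumberTheory.EllipticCurves.ModularForms WeierstrassCurve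

end Literature.NumberTheory.EllipticCurves

namespace Summit.BirchSwinnertonDyer.BirchSwinnertonDyer.Theorems.KolyvaginDepthDoor

open Literature.NumberTheory.EllipticCurves Literature.NumberTheory.EllipticCurves.ModularForms
  WeierstrassCurve
open Summit.BirchSwinnertonDyer.BirchSwinnertonDyer.Rank2Observatory
open Summit.BirchSwinnertonDyer.BirchSwinnertonDyer.Rank1Residual
open Summit.BirchSwinnertonDyer.Rank1Residual.Additive

/-! ## Row `389a1` = `[0,1,1,-2,0]` (`N = Δ = 389`) at `(p, d_K, ℓ) = (3, -7, 5)` -/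

namespace C389a1.AtThree

/-- The integral model of `389a1` (on the tree's `ℤ`-literal handle) is `[0, 1, 1, -2, 0]`.
[cite: CremonaAlgorithms1997, Table 1 (389a1)] -/
theorem intModel :
    haveI := isGloballyMinimal_c389a1;
    integralModelInt ((⟨0, 1, 1, -2, 0⟩ : WeierstrassCurve ℤ).map (Int.castRingHom ℚ)) =
      ⟨0, 1, 1, -2, 0⟩ := by
  haveI := isGloballyMinimal_c389a1
  exact IntModel.integralModelInt_eq_of_map_eq _ rfl

/-- `#Ẽ(𝔽_11) = 16`, `a_11 = -4` for `389a1` (irreducibility witness at `p = 3`: `X² + 4X + 11` has no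
root mod `3`), kernel-decided (`PointCountNat.natCard_point_map_eq`). [cite: CremonaAlgorithms1997, Table 1 (389a1)] -/
theorem card_11 :
    Nat.card (((⟨0, 1, 1, -2, 0⟩ : WeierstrassCurve ℤ).map (Int.castRingHom (ZMod 11))).toAffine.Point)
      = 16 := by
  rw [PointCountNat.natCard_point_map_eq (hℓ := ⟨by norm_num⟩) (by norm_num) 0 1 1 (-2) 0
    (by decide +kernel)]
  decide +kernel

/-- **`3 ∈ B(389a1)`: `ρ̄_{E,3^m}` is onto for every `m`** (unconditional): semistable
(`gcd(c₄, Δ) = 1`), `X² − a_11 X + 11` (`a_11 = -4`) root-free mod `3` (`E[3]` irreducible, Mazur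
6.3; onto, Serre Prop. 21), and the multiplicative prime `389 ∥ Δ` (`3 ∤ 1`: a transvection lifts
the image to `GL₂(ℤ/3^m)`). [cite: Serre1972, §5.4 Prop. 21] [cite: SerreAbelianLadic1968, Ch. IV §3.4] -/
theorem hasSurjectiveModNGaloisRep_pow_3 (m : ℕ) :
    ((⟨0, 1, 1, -2, 0⟩ : WeierstrassCurve ℤ).map (Int.castRingHom ℚ)).HasSurjectiveModNGaloisRep
      (3 ^ m : ℕ) := by
  have hn : ∀ t : ZMod 3, t ^ 2 - (((11 : ℕ) : ℤ) + 1 - (16 : ℕ) : ℤ) * t + ((11 : ℕ) : ZMod 3) ≠ 0 := by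
    decide +kernel
  haveI := Fact.mk (by norm_num : Nat.Prime 3)
  haveI := Fact.mk (by norm_num : Nat.Prime 11)
  haveI := isElliptic_c389a1
  haveI := isGloballyMinimal_c389a1
  exact hasSurjectiveModNGaloisRep_pow_of_intModel_certificate intModel
    (by rw [Int.isCoprime_iff_gcd_eq_one]; decide +kernel) 3 11 (by norm_num) (by decide +kernel)
    (n := 16) card_11 hn 389 (by norm_num) (by norm_num) (by decide +kernel) (by decide +kernel)
    (e := 1) (by decide +kernel) (by decide +kernel) (by decide +kernel) m

/-- **`3` is a prime of good ORDINARY reduction for `389a1`** (`3 ∤ Δ = 389`, `a_3 = -2`).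
[cite: CremonaAlgorithms1997, Table 1 (389a1)] -/
theorem goodOrdinary_3 :
    haveI := Fact.mk (by norm_num : Nat.Prime 3);
    haveI := isGloballyMinimal_c389a1;
    ((⟨0, 1, 1, -2, 0⟩ : WeierstrassCurve ℤ).map (Int.castRingHom ℚ)).HasGoodReductionAtPrime 3 ∧
      ¬ ((3 : ℕ) : ℤ) ∣ ((⟨0, 1, 1, -2, 0⟩ : WeierstrassCurve ℤ).map (Int.castRingHom ℚ)).frobeniusTrace 3 := by
  haveI := Fact.mk (by norm_num : Nat.Prime 3)
  haveI := isGloballyMinimal_c389a1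
  exact goodOrdinary_of_intModel_certificate intModel 3 (by decide +kernel) (n := 6) C389a1.card_3
    (by decide +kernel)

/-- **`5` is a Kolyvagin prime for `(389a1, p = 3, d_K = -7)` with `M(5) ≥ 1`** (unconditional):
`5 ∤ 389·7·3`, `(-7/5) = -1` (inert), `3 ∣ 5 + 1`, `3 ∣ a_5 = -3`. [cite: WZhang2014, Notations (xii)]
[cite: JetchevLauterStein2009, §3.6 (arXiv:0707.0032 p. 8: "ℓ = 5 is a Kolyvagin prime for E, p and D")] -/
theorem isKolyvaginPrime_5_neg7 (K : Type) [Field K] [NumberField K] (hK : IsImaginaryQuadratic K)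
    (hD : NumberField.discr K = -7) :
    haveI := Fact.mk (by norm_num : Nat.Prime 3);
    haveI := isGloballyMinimal_c389a1;
    Zhang2014.IsKolyvaginPrime
        (((⟨0, 1, 1, -2, 0⟩ : WeierstrassCurve ℤ).map (Int.castRingHom ℚ)).conductorNorm ℤ)
        ((⟨0, 1, 1, -2, 0⟩ : WeierstrassCurve ℤ).map (Int.castRingHom ℚ)) K 3 5 ∧
      (1 : ℕ∞) ≤ Zhang2014.levelIndex ((⟨0, 1, 1, -2, 0⟩ : WeierstrassCurve ℤ).map (Int.castRingHom ℚ)) 3 5 := by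
  haveI := Fact.mk (by norm_num : Nat.Prime 3)
  haveI := isElliptic_c389a1
  haveI := isGloballyMinimal_c389a1
  exact isKolyvaginPrime_of_intModel_certificate intModel 3 K hK.1 hD 5 (by norm_num) (by norm_num)
    (by decide +kernel) (by norm_num) (by norm_num) (by norm_num) (by norm_num) (n := 9) C389a1.card_5
    (by norm_num)

/-- **JLS ROW `389a1` at `(p, d_K, ℓ) = (3, -7, 5)` — a FILLED depth-table row: the computed bit is
Jetchev–Lauter–Stein's Prop. 3.10 (`κ_{5,1} ≠ 0`), taken as the named fact `hJ`; the structure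
theorem is Kolyvagin 1991 Thm. 4 in its printed `B(E)` form, the named fact `hK`; EVERYTHING ELSE is
proved in the kernel** (`3 ∈ B(E)` via `hasSurjectiveModNGaloisRep_pow_3`; `3 ∤ N`; Heegner
hypothesis for `(389, -7)`; `5` a Kolyvagin prime, `M(5) ≥ 1`; `2 ≤ rank_ℤ E(ℚ)` by the tree's kernel
certificate `Curve389a1.two_le_mordellWeilRank`; global minimality). CONCLUSION, for ANY imaginary
quadratic `K` with `d_K = -7`: `corank_{ℤ_3} Ш(E/ℚ)[3^∞] = 0`, `rank_ℤ E(ℚ) = 2` EXACTLY,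
`corank_{ℤ_3} Sel_{3^∞}(E/ℚ) = 2`, `corank_{ℤ_3} Sel_{3^∞}(E^{(-7)}/ℚ) = 1`. The route's CALIBRATION
data point ("JLS Prop. 3.10: κ_{5,1} ≠ 0 at depth 1 = rank − 1 — consistent") made a theorem:
modulo {Kolyvagin's theorem, the published computation} the anticyclotomic depth door certifies the
cotorsion-freeness of `Ш(389a1)[3^∞]` with no `3`-adic `L`-function, main conjecture or `3`-adic
height. `p = 3` is below the crux's `p ≥ 5`: this calibrates the instrument, it does not instantiate
`KolyvaginDepthSupply`; BSD is not proved by it. CONDITIONAL on `hK`, `hJ`.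
[cite: JetchevLauterStein2009, §3.6 Prop. 3.10 (arXiv:0707.0032 p. 8)]
[cite: Kolyvagin1991MathAnn, §2 Thm. 4 (= typescript Thm. 2.3)] [cite: CremonaAlgorithms1997, Table 1 (389a1)] -/
theorem jlsRow_3_neg7_5
    (hK : Kolyvagin1991_selmerCorank_of_kolyvaginClass_ne_zero_of_padicSurj)
    (hJ : Literature.NumberTheory.EllipticCurves.JetchevLauterStein2009_kolyvaginClass_five_ne_zero_at_three)
    (K : Type) [Field K] [NumberField K] (hIQ : IsImaginaryQuadratic K)
    (hD : NumberField.discr K = -7) :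
    ((⟨0, 1, 1, -2, 0⟩ : WeierstrassCurve ℤ).map (Int.castRingHom ℚ)).shaCorank 3 = 0 ∧
      ((⟨0, 1, 1, -2, 0⟩ : WeierstrassCurve ℤ).map (Int.castRingHom ℚ)).mordellWeilRank = 2 ∧
      ((⟨0, 1, 1, -2, 0⟩ : WeierstrassCurve ℤ).map (Int.castRingHom ℚ)).selmerCorank 3 = 2 ∧
      (((⟨0, 1, 1, -2, 0⟩ : WeierstrassCurve ℤ).map (Int.castRingHom ℚ)).quadraticTwist
        ((-7 : ℤ) : ℚ)).selmerCorank 3 = 1 := by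
  haveI := isElliptic_c389a1
  haveI := isGloballyMinimal_c389a1
  haveI : NeZero (((⟨0, 1, 1, -2, 0⟩ : WeierstrassCurve ℤ).map (Int.castRingHom ℚ)).conductorNorm ℤ) :=
    neZero_conductorNorm_of_isElliptic _
  haveI := Fact.mk (by norm_num : Nat.Prime 3)
  -- the computed bit (JLS Prop. 3.10)
  obtain ⟨Dt, β, ι, d, hne⟩ := hJ.1 K hIQ hD
  -- the kernel rank certificate, moved from `Curve389a1.E` to the `ℤ`-literal handle
  have hr : 2 ≤ ((⟨0, 1, 1, -2, 0⟩ : WeierstrassCurve ℤ).map (Int.castRingHom ℚ)).mordellWeilRank := by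
    rw [IntModel.map_mk_int]
    exact Curve389a1.two_le_mordellWeilRank
  exact depthRow_of_intModel_certificate_padic intModel hK hr 3 (by norm_num) (by decide +kernel)
    hasSurjectiveModNGaloisRep_pow_3 K hIQ hD (by norm_num) (by norm_num) (by norm_num)
    C389a1.heegner_neg7 5 (by norm_num) (by norm_num) (by decide +kernel) (by norm_num) (by norm_num)
    (by norm_num) (by norm_num) (n := 9) C389a1.card_5 (by norm_num) Dt β ι d hne

end C389a1.AtThree

end Summit.BirchSwinnertonDyer.BirchSwinnertonDyer.Theorems.KolyvaginDepthDoor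

end
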